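import Literature.AnabelianGeometry.AbsoluteAnabelian.MLFGaloisGroupification
import Literature.AnabelianGeometry.AbsoluteAnabelian.MLFGaloisIntrinsic

/-!
# The natural functor `𝒞^MLF_TM → 𝒞^MLF_TCG` (invertible elements) of [AbsTopIII] Definition 3.1 (iii)

S. Mochizuki, *Topics in absolute anabelian geometry III*, §3, Def. 3.1 (iii) p. 68 (bib key
`MochizukiAbsTopIII2015`; locators = kurims manuscript pages, lit key `paper:url-5493eb38cbb7`):
"… we thus obtain natural functors `𝒞^MLF_TF → 𝒞^MLF_TM`; `𝒞^MLF_TM → 𝒞^MLF_TLG`; `𝒞^MLF_TM → 𝒞^MLF_TCG`;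
`𝒞^MLF_TLG → 𝒞^MLF_TCG` — i.e., by taking … the subgroup of invertible elements `M^×` of the arithmetic
data `M`, …".

This file (seat abc-iut-L4-t2; sub-DAG row P32.0.r0 of `plan/L4/SUBDAG-AbsTopIII-Prop32.md`) makes the
THIRD of these functors a REAL functor on abstract pairs (companion of `MLFGaloisGroupification`, which
does the second):

* `GaloisMonoidPair.unitsPair P = (Π ↷ M^×)` — `M^× = Mˣ` (Mathlib units) with the induced action
  (`unitsMulDistribMulAction`, a reducible `def` made a local instance: `g • u = (g • u, g • u⁻¹)`; Mathlib
  deliberately has no such global instance, cf. the module docstring of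
  `Mathlib.Algebra.GroupWithZero.Action.Units`) — stabilisers are open since `Stab(u) = Stab(u : M)`;
* `GaloisMonoidPair.Iso.units`, `GaloisMonoidPair.Hom.units` — functoriality (Def. 3.1 (ii)); for
  morphisms the arithmetic kernels of `M` and `M^×` must agree, which is NOT formal (`𝒪_k̄^⊳` is not
  generated by its units) but holds for MLF-Galois `TM`-pairs: an element of `G_k` fixing every unit of
  `𝒪_k̄` fixes `𝒪_k̄` (a non-unit integer `z` has `1 + z ∈ 𝒪_k̄^×`, `MLFGaloisIntrinsic`) hence `k̄`
  (`actionKer_unitsPair_tmPair`, `actionKer_unitsPair_of_TM`);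
* MODEL: `ModelMLFGaloisData.unitsIsoTCG : (Π_k ↷ (𝒪_k̄^⊳)^×) ⥲ (Π_k ↷ 𝒪_k̄^×)` (`(𝒪_k̄^⊳)^× = 𝒪_k̄^×`,
  `unitsEquivUnitSubmonoid`), hence `isMLFGaloisMonoidPair_TCG_unitsPair` and the functor
  `tmToTCG : MLFGaloisMonoidPairCat TM ⥤ MLFGaloisMonoidPairCat TCG`, compatible with `(Π ↷ M) ↦ Π` on the
  nose (`tmToTCG_homPi`).

Deliberately NOT here: `𝒞_TLG → 𝒞_TCG` ("maximal compact subgroups of the subgroups of invariants", read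
intrinsically via Rmk. 3.1.1) and `𝒞_TF → 𝒞_TM` on morphisms — next files of this seat.
HONEST FRAMING: OUR kernel constructions of classical objects named by a refereed 2015 paper; nothing
here bears on [IUTchIII] Cor. 3.12; typed ≠ proved for anything downstream.
-/

noncomputable section

universe u

namespace Literature.AnabelianGeometry.AbsoluteAnabelian

open _root_.CategoryTheory
open _root_.ValuativeRel
open Literature.NumberTheory.GaloisRepresentations

/-! ### The induced action on the units of a monoid -/

section UnitsAction

variable {G : Type*} [Monoid G] {M : Type u} [Monoid M] [MulDistribMulAction G M]

/-- **The induced action on invertible elements.**  An action of `G` on a monoid `M` by monoid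
endomorphisms induces an action on `M^× = Mˣ` by group automorphisms, `g • u := (g • u, g • u⁻¹)`
(`Units.map` of the endomorphism `g • ·`).  A reducible `def`, used as a local instance and as the action
of the pair `GaloisMonoidPair.unitsPair`; not a global instance (Mathlib has none on purpose).
[cite: MochizukiAbsTopIII2015, Definition 3.1 (iii) p.68] -/
@[reducible] def unitsMulDistribMulAction : MulDistribMulAction G Mˣ where
  smul g u := Units.map (MulDistribMulAction.toMonoidHom M g) u
  one_smul u := Units.ext (one_smul G (u : M))
  mul_smul g h u := Units.ext (mul_smul g h (u : M))
  smul_mul g u v := Units.ext (smul_mul' g (u : M) (v : M))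
  smul_one g := Units.ext (smul_one g)

attribute [local instance] unitsMulDistribMulAction

/-- The induced action on units, on underlying elements: `↑(g • u) = g • ↑u`.
[cite: MochizukiAbsTopIII2015, Definition 3.1 (iii) p.68] -/
@[simp] theorem units_val_smul (g : G) (u : Mˣ) : ((g • u : Mˣ) : M) = g • (u : M) := rfl

end UnitsAction

attribute [local instance] unitsMulDistribMulAction

/-! ### Def 3.1 (iii): the pair of invertible elements `(Π ↷ M) ↦ (Π ↷ M^×)` -/

namespace GaloisMonoidPair

variable (P : GaloisMonoidPair.{u}) {Q R : GaloisMonoidPair.{u}}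

/-- **Def 3.1 (iii), `𝒞_TM → 𝒞_TCG` on objects: the pair `(Π ↷ M^×)` of invertible elements of a pair
`(Π ↷ M)`** ("the subgroup of invertible elements `M^×` of the arithmetic data `M`"), with the induced
action; the stabiliser of a unit `u` is the (open) stabiliser of `u ∈ M`.
[cite: MochizukiAbsTopIII2015, Definition 3.1 (iii) p.68] -/
def unitsPair : GaloisMonoidPair.{u} where
  Pi := P.Pi
  M := P.Mˣ
  instAction := unitsMulDistribMulAction
  isOpen_stabilizer u := by
    refine Subgroup.isOpen_mono (H₁ := MulAction.stabilizer P.Pi (u : P.M)) ?_ (P.isOpen_stabilizer (u : P.M))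
    intro g hg
    rw [MulAction.mem_stabilizer_iff] at hg
    rw [MulAction.mem_stabilizer_iff]
    exact Units.ext hg

/-- The topological group of `P.unitsPair` is that of `P`. [cite: MochizukiAbsTopIII2015, Definition 3.1 (iii) p.68] -/
theorem unitsPair_Pi : P.unitsPair.Pi = P.Pi := rfl

/-- The arithmetic data of `P.unitsPair` is `M^×`. [cite: MochizukiAbsTopIII2015, Definition 3.1 (iii) p.68] -/
theorem unitsPair_M : P.unitsPair.M = P.Mˣ := rfl

/-- The action of `P.unitsPair` is the induced action on `Mˣ` (definitional).
[cite: MochizukiAbsTopIII2015, Definition 3.1 (iii) p.68] -/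
theorem unitsPair_smul_eq (g : P.Pi) (u : P.Mˣ) :
    (HSMul.hSMul (α := P.unitsPair.Pi) (β := P.unitsPair.M) g u) = g • u := rfl

/-- `g` acts trivially on `M` ⟹ `g` acts trivially on `M^×`. [cite: MochizukiAbsTopIII2015, Definition 3.1 (iii) p.68] -/
theorem actionKer_le_actionKer_unitsPair : P.actionKer ≤ P.unitsPair.actionKer := by
  intro g hg
  have hg' := (P.mem_actionKer_iff g).mp hg
  refine (P.unitsPair.mem_actionKer_iff g).mpr fun u => ?_
  change HSMul.hSMul (α := P.Pi) (β := P.Mˣ) g u = u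
  exact Units.ext (hg' (Units.val u))

variable {P}

/-- **Functoriality on isomorphisms of pairs**: `(Π ↷ M) ≅ (Π' ↷ M')` induces `(Π ↷ M^×) ≅ (Π' ↷ M'^×)`.
[cite: MochizukiAbsTopIII2015, Definition 3.1 (iii) p.68] -/
def Iso.units (e : GaloisMonoidPair.Iso P Q) : GaloisMonoidPair.Iso P.unitsPair Q.unitsPair where
  isoPi := e.isoPi
  isoM := Units.mapEquiv e.isoM
  smul_comm g u := Units.ext (e.smul_comm g (Units.val u))

/-- The Galois component of `e.units` is that of `e`. [cite: MochizukiAbsTopIII2015, Definition 3.1 (iii) p.68] -/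
@[simp] theorem Iso.units_isoPi (e : GaloisMonoidPair.Iso P Q) : e.units.isoPi = e.isoPi := rfl

/-- The object component of `e.units` on underlying elements. [cite: MochizukiAbsTopIII2015, Definition 3.1 (iii) p.68] -/
@[simp] theorem Iso.units_isoM_val (e : GaloisMonoidPair.Iso P Q) (u : P.Mˣ) :
    Units.val (e.units.isoM u) = e.isoM (u : P.M) := rfl

/-- Transport of the equality "arithmetic kernel of `M^×` = arithmetic kernel of `M`" along an
isomorphism of pairs. [cite: MochizukiAbsTopIII2015, Definition 3.1 (iii) p.68] -/
theorem actionKer_unitsPair_eq_of_iso (e : GaloisMonoidPair.Iso P Q)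
    (hP : P.unitsPair.actionKer = P.actionKer) : Q.unitsPair.actionKer = Q.actionKer := by
  rw [← e.map_actionKer, ← e.units.map_actionKer, hP]
  rfl

/-- **Functoriality on morphisms of pairs** (Def 3.1 (ii)): `φ = (φ_Π, φ_M)` induces `(φ_Π, φ_M|_{M^×})`,
provided the arithmetic kernels of `M` and `M^×` agree for source and target (true for MLF-Galois
`TM`-pairs, `actionKer_unitsPair_of_TM`). [cite: MochizukiAbsTopIII2015, Definition 3.1 (iii) p.68] -/
def Hom.units (φ : P.Hom Q) (hP : P.unitsPair.actionKer = P.actionKer)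
    (hQ : Q.unitsPair.actionKer = Q.actionKer) : P.unitsPair.Hom Q.unitsPair where
  homPi := φ.homPi
  continuous_homPi := φ.continuous_homPi
  homM := Units.map φ.homM
  smul_comm g u := Units.ext (φ.smul_comm g (Units.val u))
  comap_ker := by
    rw [hQ, hP]
    exact φ.comap_ker
  isOpen_image U hU := by
    rw [hQ]
    exact φ.isOpen_image U hU

/-- The Galois component of `φ.units` is `φ_Π`. [cite: MochizukiAbsTopIII2015, Definition 3.1 (iii) p.68] -/
@[simp] theorem Hom.units_homPi (φ : P.Hom Q) (hP hQ) : (φ.units hP hQ).homPi = φ.homPi := rfl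

/-- The object component of `φ.units` is `Units.map φ_M`. [cite: MochizukiAbsTopIII2015, Definition 3.1 (iii) p.68] -/
@[simp] theorem Hom.units_homM (φ : P.Hom Q) (hP hQ) : (φ.units hP hQ).homM = Units.map φ.homM := rfl

end GaloisMonoidPair

/-! ### The model: `(𝒪_k̄^⊳)^× = 𝒪_k̄^×`, and `G_k` acts faithfully on `𝒪_k̄^×` -/

namespace ModelMLFGaloisData

variable (C : MLFClosure.{u}) (D : ModelMLFGaloisData C.k C.K)

/-- **`(𝒪_k̄^⊳)^× = 𝒪_k̄^×`**: the units of the monoid `𝒪_k̄^⊳` are the units of the ring `𝒪_k̄`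
(`𝒪_k̄^× = 𝒪_k̄^⊳ ∩ (𝒪_k̄^⊳)⁻¹`, `MLFClosure.mem_unitSubmonoid_iff_mem_nonzeroIntegers_and_inv_mem`).
[cite: MochizukiAbsTopIII2015, Definition 3.1 (i) p.66] -/
def unitsEquivUnitSubmonoid : (nonzeroIntegers C.k C.K)ˣ ≃* unitSubmonoid C.k C.K where
  toFun u := ⟨((u : nonzeroIntegers C.k C.K) : C.K),
    (C.mem_unitSubmonoid_iff_mem_nonzeroIntegers_and_inv_mem).mpr ⟨(u : nonzeroIntegers C.k C.K).2, by
      have hmul : (((u⁻¹ : (nonzeroIntegers C.k C.K)ˣ) : nonzeroIntegers C.k C.K) : C.K) *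
          ((u : nonzeroIntegers C.k C.K) : C.K) = 1 := by
        rw [← Submonoid.coe_mul, ← Units.val_mul, inv_mul_cancel]
        rfl
      rw [inv_eq_of_mul_eq_one_left hmul]
      exact ((u⁻¹ : (nonzeroIntegers C.k C.K)ˣ) : nonzeroIntegers C.k C.K).2⟩⟩
  invFun x := ⟨⟨x, C.mem_nonzeroIntegers_of_mem_unitSubmonoid x.2⟩,
    ⟨(x : C.K)⁻¹, C.mem_nonzeroIntegers_of_mem_unitSubmonoid (C.inv_mem_unitSubmonoid x.2)⟩,
    Subtype.ext (mul_inv_cancel₀ ((mem_unitSubmonoid_iff C.k C.K).mp x.2).1),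
    Subtype.ext (inv_mul_cancel₀ ((mem_unitSubmonoid_iff C.k C.K).mp x.2).1)⟩
  left_inv u := Units.ext (Subtype.ext rfl)
  right_inv x := Subtype.ext rfl
  map_mul' u v := Subtype.ext rfl

/-- `unitsEquivUnitSubmonoid` on underlying elements of `k̄`. [cite: MochizukiAbsTopIII2015, Definition 3.1 (i) p.66] -/
@[simp] theorem coe_unitsEquivUnitSubmonoid (u : (nonzeroIntegers C.k C.K)ˣ) :
    ((unitsEquivUnitSubmonoid C u : unitSubmonoid C.k C.K) : C.K) = ((u : nonzeroIntegers C.k C.K) : C.K) := rfl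

/-- **The pair of invertible elements of the model `TM`-pair is the model `TCG`-pair**:
`(Π_k ↷ (𝒪_k̄^⊳)^×) ⥲ (Π_k ↷ 𝒪_k̄^×)` (identity on `Π_k`; both actions are through `ε_k` on `k̄`).
[cite: MochizukiAbsTopIII2015, Definition 3.1 (iii) p.68] -/
def unitsIsoTCG : GaloisMonoidPair.Iso D.tmPair.unitsPair D.tcgPair where
  isoPi := ContinuousMulEquiv.refl _
  isoM := unitsEquivUnitSubmonoid C
  smul_comm _ _ := Subtype.ext rfl

/-- For the model `TM`-pair the arithmetic kernels of `𝒪_k̄^⊳` and of its units agree (both are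
`Ker ε_k`): **`G_k` acts faithfully on `𝒪_k̄^×`** — an element of `G_k` fixing every unit fixes every
integer `z` (`z` or `1 + z` is a unit, `one_add_mem_unitSubmonoid_of_mem_integersClosure`) hence every
`x = z` or `z⁻¹` of `k̄^×` (`mem_nonzeroIntegers_or_inv_mem`).  (Universe-polymorphic; the universe-`0`
statement `MLFClosure.algEquiv_eq_one_of_forall_unitSubmonoid` / `tcgPair_actionKer` of
`MonoidKummerMapsTCGLiftProofs` is the same argument.) [cite: MochizukiAbsTopIII2015, Definition 3.1 (ii) p.67] -/
theorem actionKer_unitsPair_tmPair : D.tmPair.unitsPair.actionKer = D.tmPair.actionKer := by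
  refine le_antisymm ?_ D.tmPair.actionKer_le_actionKer_unitsPair
  intro g hg
  have hg' := (D.tmPair.unitsPair.mem_actionKer_iff g).mp hg
  -- `ε_k(g)` fixes every unit of `𝒪_k̄`
  have hunit : ∀ x ∈ unitSubmonoid C.k C.K, D.aug g x = x := fun x hx =>
    congrArg (fun u : (nonzeroIntegers C.k C.K)ˣ => ((u : nonzeroIntegers C.k C.K) : C.K))
      (hg' ((unitsEquivUnitSubmonoid C).symm ⟨x, hx⟩))
  -- hence every integer
  have hint : ∀ z ∈ nonzeroIntegers C.k C.K, D.aug g z = z := by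
    intro z hz
    by_cases hzu : z ∈ unitSubmonoid C.k C.K
    · exact hunit z hzu
    · have h1 := hunit (1 + z) (one_add_mem_unitSubmonoid_of_mem_integersClosure C hz.1 hzu)
      rw [map_add, map_one] at h1
      exact add_left_cancel h1
  -- hence `ε_k(g) = 1`
  have h1 : D.aug g = 1 := by
    apply AlgEquiv.ext
    intro x
    rcases eq_or_ne x 0 with rfl | hx0
    · simp
    rcases C.mem_nonzeroIntegers_or_inv_mem hx0 with hx | hx
    · exact hint x hx
    · have h2 := hint x⁻¹ hx
      rw [map_inv₀] at h2
      exact inv_injective h2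
  refine (D.tmPair.mem_actionKer_iff g).mpr fun m => Subtype.ext ?_
  change D.aug g • (m : C.K) = m
  rw [h1, one_smul]

/-- **For an MLF-Galois `TM`-pair the arithmetic kernels of `M` and `M^×` agree** (transport of the
model statement). [cite: MochizukiAbsTopIII2015, Definition 3.1 (iii) p.68] -/
theorem _root_.Literature.AnabelianGeometry.AbsoluteAnabelian.GaloisMonoidPair.actionKer_unitsPair_of_TM
    {P : GaloisMonoidPair.{u}} (hP : IsMLFGaloisMonoidPair .TM P) :
    P.unitsPair.actionKer = P.actionKer := by
  obtain ⟨C, D, Q, hQ, ⟨e⟩⟩ := hP.exists_model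
  have hQ' : D.tmPair = Q := Option.some_injective _ (D.monoidPair_TM.symm.trans hQ)
  subst hQ'
  exact GaloisMonoidPair.actionKer_unitsPair_eq_of_iso e (actionKer_unitsPair_tmPair C D)

/-- **Def 3.1 (iii) preserves MLF-Galois pairs**: the pair of invertible elements of an MLF-Galois
`TM`-pair is an MLF-Galois `TCG`-pair. [cite: MochizukiAbsTopIII2015, Definition 3.1 (iii) p.68] -/
theorem _root_.Literature.AnabelianGeometry.AbsoluteAnabelian.GaloisMonoidPair.isMLFGaloisMonoidPair_TCG_unitsPair
    {P : GaloisMonoidPair.{u}} (hP : IsMLFGaloisMonoidPair .TM P) :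
    IsMLFGaloisMonoidPair .TCG P.unitsPair := by
  obtain ⟨C, D, Q, hQ, ⟨e⟩⟩ := hP.exists_model
  have hQ' : D.tmPair = Q := Option.some_injective _ (D.monoidPair_TM.symm.trans hQ)
  subst hQ'
  exact ⟨⟨C, D, D.tcgPair, D.monoidPair_TCG, ⟨(unitsIsoTCG C D).symm.trans e.units⟩⟩⟩

end ModelMLFGaloisData

/-! ### Def 3.1 (iii): the functor `𝒞^MLF_TM → 𝒞^MLF_TCG` -/

/-- **Def 3.1 (iii): the natural functor `𝒞^MLF_TM → 𝒞^MLF_TCG`, `(Π ↷ M) ↦ (Π ↷ M^×)`** ("by taking … the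
subgroup of invertible elements `M^×` of the arithmetic data `M`"); on morphisms
`(φ_Π, φ_M) ↦ (φ_Π, φ_M|_{M^×})`. [cite: MochizukiAbsTopIII2015, Definition 3.1 (iii) p.68] -/
def tmToTCG : MLFGaloisMonoidPairCat.{u} .TM ⥤ MLFGaloisMonoidPairCat.{u} .TCG where
  obj P := ⟨P.obj.unitsPair, GaloisMonoidPair.isMLFGaloisMonoidPair_TCG_unitsPair P.property⟩
  map {P Q} φ := InducedCategory.homMk (GaloisMonoidPair.Hom.units (P := P.obj) (Q := Q.obj) φ.hom
    (GaloisMonoidPair.actionKer_unitsPair_of_TM P.property) (GaloisMonoidPair.actionKer_unitsPair_of_TM Q.property))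
  map_id _ := InducedCategory.Hom.ext (GaloisMonoidPair.Hom.ext rfl (by
    change Units.map (MonoidHom.id _) = MonoidHom.id _
    exact Units.map_id _))
  map_comp _ _ := InducedCategory.Hom.ext (GaloisMonoidPair.Hom.ext rfl (by
    change Units.map (MonoidHom.comp _ _) = (Units.map _).comp (Units.map _)
    exact (Units.map_comp _ _).symm))

/-- `tmToTCG` is compatible with the forgetful assignment `(Π ↷ M) ↦ Π` ON THE NOSE (same `Π`, same `φ_Π`).
[cite: MochizukiAbsTopIII2015, Definition 3.1 (iii) p.68] -/
theorem tmToTCG_homPi {P Q : MLFGaloisMonoidPairCat.{u} .TM} (φ : P ⟶ Q) :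
    (tmToTCG.map φ).hom.homPi = GaloisMonoidPair.Hom.homPi (P := P.obj) (Q := Q.obj) φ.hom := rfl

end Literature.AnabelianGeometry.AbsoluteAnabelian

end
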